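import Summits.Ventures.Crystal3D.Theorems.StickyWulffConstantNoReconstructionGainGrainFrameBudgetThree
import Summits.Ventures.Crystal3D.Theorems.StickyWulffConstantNoReconstructionGainBarlowGrainFilmCone
import Summits.Ventures.Crystal3D.Theorems.StickyWulffConstantNoReconstructionGainBarlowSegmentGlue
import Summits.Ventures.Crystal3D.Theorems.StickyWulffConstantNoReconstructionGainCapLocal
import HarnessLib

/-!
# The pred-slot budget versus the landed cap budget: pair comparisons, coordinates, the half-turn

HONEST FRAMING. Part of the venture `Summits/Ventures/Crystal3D` (cell `crystal3d-full`), helper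
`--supports` the crux `NoReconstructionGain` (stmt-Ventures-19144, route
`route-Ventures-StickyWulffConstant`), line `adhesion` (wulff-p1 g14).  Bricks for the companion file
`…NoReconstructionGainPredSlotBudgetCone`, which closes the registered brick B1a
`predSlotBudget_of_upTriple_below` of skeleton v20 (the pred-slot budget `stub_predSlotBudget70` of g13 in
the case that the three up bonds are strictly `ν`-below) by READING THE LANDED CAP BUDGET BACKWARDS:

* `card_filter_toFinset_le_sum`, `image_toFinset_eq_map` — counting over an explicit list;
* `frameCapBudget_sum_le` — the landed cap budget `stub_frameCapBudget` (`…GrainFrameBudgetThree`, g12)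
  evaluated on the explicit twelve-direction bond star of `Λ₀` (`…CapLocal`) and bounded by the sum of its
  twelve per-direction indicators (down-and-credited `1`, level-and-blocked `½`);
* `pair_hex_le`, `pair_hex_le'`, `pair_down_le` — antipodal pair comparisons: a strictly `ν`-down direction
  carries exactly its landed credit; a hex pair (pred-slot representative = the `ν`-lower one, `−A h` when
  level) loses at most `½`, and only when LEVEL; `natCast_le_of_le_indicators_add_half` — integrality;
* `upBonds_two_blocked`, `not_three_neg_products`, `upBond_blocked_of_three` — the axis-parallel normal in
  coordinates: a unit vector of height `> h = √(2/3)` is within `60°` of two of the three up bonds (their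
  inner products sum to `3 h z > 2`, each `≤ 1`); three such vectors pairwise `≥ 60°` apart cannot all
  avoid one up bond (their horizontal parts would be pairwise obtuse inside an open half-plane);
* `hexUp_inner_apply`, `upBonds_eq_neg`, `halfTurn_eq`, `halfTurn_bonds` — coordinates of the hex bonds,
  the up bonds and the axis; the half-turn `R_π = (−1) ∘ M` about the axis negates the hex bonds, fixes
  the axis and maps the up-triple of letter `+1` onto that of letter `−1`.

WHAT THIS IS NOT: the budget itself (companion file); no packing appears here; rung F-C1 not moved.
-/

noncomputable section

namespace Summit.Ventures.Crystal3D.Theorems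

open Summit.Ventures.Crystal3D Finset
open Literature.MathematicalPhysics.StatisticalMechanics (fccStacking barlowPos constHagg barlowPos_mem
  threeOffsets barlowPos_apply_zero barlowPos_apply_one barlowPos_apply_two haggLabel_const)
open Literature.Algebra.EuclideanLattices (inner_fin_three norm_sq_fin_three)
open scoped InnerProductSpace

/-! ### Counting: a filter of an explicit list is bounded by the sum of indicators -/

/-- `#(filter q l.toFinset) ≤ Σ_{x ∈ l} [q x]` (as reals). -/
theorem card_filter_toFinset_le_sum {α : Type*} [DecidableEq α] (q : α → Prop) [DecidablePred q]
    (l : List α) :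
    (((l.toFinset).filter q).card : ℝ) ≤ (l.map fun x => if q x then (1 : ℝ) else 0).sum := by
  induction l with
  | nil => simp
  | cons a l ih =>
    rw [List.toFinset_cons, Finset.filter_insert, List.map_cons, List.sum_cons]
    split_ifs with h
    · have h1 : ((insert a (l.toFinset.filter q)).card : ℝ) ≤ (l.toFinset.filter q).card + 1 := by
        exact_mod_cast Finset.card_insert_le _ _
      linarith
    · linarith

/-- The image of `l.toFinset` is `(l.map f).toFinset`. -/
theorem image_toFinset_eq_map {α β : Type*} [DecidableEq α] [DecidableEq β] (f : α → β) (l : List α) :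
    (l.toFinset).image f = (l.map f).toFinset := by
  ext x; simp


/-! ### The landed cap budget on the explicit bond star, as a twelve-term sum -/

/-- The landed cap budget `stub_frameCapBudget` (`…GrainFrameBudgetThree`) evaluated on the explicit
bond star of `Λ₀` and bounded above by the sum of its twelve per-direction indicators. -/
theorem frameCapBudget_sum_le (A : EuclideanSpace ℝ (Fin 3) ≃ₗᵢ[ℝ] EuclideanSpace ℝ (Fin 3))
    (ν : EuclideanSpace ℝ (Fin 3)) (hν : ‖ν‖ = 1) (t : ℝ) (ht : 0 < t)
    (K : Finset (EuclideanSpace ℝ (Fin 3))) (hK : K.card ≤ 3)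
    (hK1 : ∀ u ∈ K, ‖u‖ = 1 ∧ ⟪u, ν⟫_ℝ ≤ -t) (hK2 : ∀ u ∈ K, ∀ u' ∈ K, u ≠ u' → ⟪u, u'⟫_ℝ ≤ 1 / 2) :
    (K.card : ℝ) ≤
      (([barlowPos 1 (Real.sqrt (2 / 3)) constHagg 0 1 0, -barlowPos 1 (Real.sqrt (2 / 3)) constHagg 0 1 0,
        barlowPos 1 (Real.sqrt (2 / 3)) constHagg 0 0 1, -barlowPos 1 (Real.sqrt (2 / 3)) constHagg 0 0 1,
        barlowPos 1 (Real.sqrt (2 / 3)) constHagg 0 1 (-1), -barlowPos 1 (Real.sqrt (2 / 3)) constHagg 0 1 (-1),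
        barlowPos 1 (Real.sqrt (2 / 3)) constHagg 1 0 0, -barlowPos 1 (Real.sqrt (2 / 3)) constHagg 1 0 0,
        barlowPos 1 (Real.sqrt (2 / 3)) constHagg (-1) 1 0, -barlowPos 1 (Real.sqrt (2 / 3)) constHagg (-1) 1 0,
        barlowPos 1 (Real.sqrt (2 / 3)) constHagg (-1) 0 1, -barlowPos 1 (Real.sqrt (2 / 3)) constHagg (-1) 0 1] :
        List (EuclideanSpace ℝ (Fin 3))).map fun d =>
          (if ⟪A d, ν⟫_ℝ < 0 ∧ ((∃ u ∈ K, 1 / 2 < ⟪u, A d⟫_ℝ) ∨ ⟪A d, ν⟫_ℝ ≤ -t) then (1 : ℝ) else 0) +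
          1 / 2 * (if ⟪A d, ν⟫_ℝ = 0 ∧ (∃ u ∈ K, 1 / 2 < ⟪u, A d⟫_ℝ) then (1 : ℝ) else 0)).sum := by
  classical
  set L := ([barlowPos 1 (Real.sqrt (2 / 3)) constHagg 0 1 0, -barlowPos 1 (Real.sqrt (2 / 3)) constHagg 0 1 0,
        barlowPos 1 (Real.sqrt (2 / 3)) constHagg 0 0 1, -barlowPos 1 (Real.sqrt (2 / 3)) constHagg 0 0 1,
        barlowPos 1 (Real.sqrt (2 / 3)) constHagg 0 1 (-1), -barlowPos 1 (Real.sqrt (2 / 3)) constHagg 0 1 (-1),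
        barlowPos 1 (Real.sqrt (2 / 3)) constHagg 1 0 0, -barlowPos 1 (Real.sqrt (2 / 3)) constHagg 1 0 0,
        barlowPos 1 (Real.sqrt (2 / 3)) constHagg (-1) 1 0, -barlowPos 1 (Real.sqrt (2 / 3)) constHagg (-1) 1 0,
        barlowPos 1 (Real.sqrt (2 / 3)) constHagg (-1) 0 1, -barlowPos 1 (Real.sqrt (2 / 3)) constHagg (-1) 0 1] :
        List (EuclideanSpace ℝ (Fin 3))) with hL
  have hU : ∀ d ∈ L.toFinset, d ∈ fccStacking 1 (Real.sqrt (2 / 3)) ∧ ‖d‖ = 1 := fun d hd => fccBondStar_mem hd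
  have hUneg : ∀ d ∈ L.toFinset, -d ∈ L.toFinset := fun d hd => fccBondStar_neg_mem hd
  have hUcard : L.toFinset.card = 12 := fccBondStar_card
  have h := stub_frameCapBudget L.toFinset hU hUneg hUcard A ν hν t ht K hK hK1 hK2
  rw [image_toFinset_eq_map] at h
  have h1 := card_filter_toFinset_le_sum
    (fun d => ⟪d, ν⟫_ℝ < 0 ∧ ((∃ u ∈ K, 1 / 2 < ⟪u, d⟫_ℝ) ∨ ⟪d, ν⟫_ℝ ≤ -t)) (L.map fun d => A d)
  have h2 := card_filter_toFinset_le_sum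
    (fun d => ⟪d, ν⟫_ℝ = 0 ∧ ∃ u ∈ K, 1 / 2 < ⟪u, d⟫_ℝ) (L.map fun d => A d)
  rw [List.map_map] at h1 h2
  rw [List.sum_map_add, List.sum_map_mul_left]
  have h1' : (((L.map fun d => A d).toFinset.filter fun d =>
      ⟪d, ν⟫_ℝ < 0 ∧ ((∃ u ∈ K, 1 / 2 < ⟪u, d⟫_ℝ) ∨ ⟪d, ν⟫_ℝ ≤ -t)).card : ℝ) ≤
      (L.map fun d => if ⟪A d, ν⟫_ℝ < 0 ∧ ((∃ u ∈ K, 1 / 2 < ⟪u, A d⟫_ℝ) ∨ ⟪A d, ν⟫_ℝ ≤ -t)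
        then (1 : ℝ) else 0).sum := by
    simpa only [Function.comp_def] using h1
  have h2' : (((L.map fun d => A d).toFinset.filter fun d =>
      ⟪d, ν⟫_ℝ = 0 ∧ ∃ u ∈ K, 1 / 2 < ⟪u, d⟫_ℝ).card : ℝ) ≤
      (L.map fun d => if ⟪A d, ν⟫_ℝ = 0 ∧ (∃ u ∈ K, 1 / 2 < ⟪u, A d⟫_ℝ) then (1 : ℝ) else 0).sum := by
    simpa only [Function.comp_def] using h2
  have hhalf : (0 : ℝ) ≤ 1 / 2 := by norm_num
  calc (K.card : ℝ) ≤ _ := h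
    _ ≤ _ := by nlinarith [h1', h2']


/-! ### Pair comparison: landed credits of an antipodal pair versus the pred-slot credit -/

/-- **Hex pair.**  For an antipodal pair `±g` the landed credits (down-and-credited counts `1`, level-and-
blocked counts `½`, for each of `g`, `−g`) are at most the pred-slot credit of the `ν`-lower representative
(`g` if `⟪g, ν⟫ < 0`, else `−g`) plus `½` if the pair is level. -/
theorem pair_hex_le (g ν : EuclideanSpace ℝ (Fin 3)) (K : Finset (EuclideanSpace ℝ (Fin 3))) (t : ℝ) :
    ((if ⟪g, ν⟫_ℝ < 0 ∧ ((∃ u ∈ K, 1 / 2 < ⟪u, g⟫_ℝ) ∨ ⟪g, ν⟫_ℝ ≤ -t) then (1 : ℝ) else 0) +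
        1 / 2 * (if ⟪g, ν⟫_ℝ = 0 ∧ (∃ u ∈ K, 1 / 2 < ⟪u, g⟫_ℝ) then (1 : ℝ) else 0)) +
      ((if ⟪-g, ν⟫_ℝ < 0 ∧ ((∃ u ∈ K, 1 / 2 < ⟪u, -g⟫_ℝ) ∨ ⟪-g, ν⟫_ℝ ≤ -t) then (1 : ℝ) else 0) +
        1 / 2 * (if ⟪-g, ν⟫_ℝ = 0 ∧ (∃ u ∈ K, 1 / 2 < ⟪u, -g⟫_ℝ) then (1 : ℝ) else 0)) ≤
      (if (∃ u ∈ K, 1 / 2 < ⟪u, if ⟪g, ν⟫_ℝ < 0 then g else -g⟫_ℝ) ∨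
            ⟪(if ⟪g, ν⟫_ℝ < 0 then g else -g), ν⟫_ℝ ≤ -t then (1 : ℝ) else 0) +
        1 / 2 * (if ⟪g, ν⟫_ℝ = 0 then (1 : ℝ) else 0) := by
  rcases lt_trichotomy ⟪g, ν⟫_ℝ 0 with hlt | heq | hgt
  · have h1 : ¬ ⟪g, ν⟫_ℝ = 0 := ne_of_lt hlt
    have h2 : ¬ ⟪-g, ν⟫_ℝ < 0 := by rw [inner_neg_left]; linarith
    have h3 : ¬ ⟪-g, ν⟫_ℝ = 0 := by rw [inner_neg_left]; linarith
    simp only [hlt, h1, h2, h3, true_and, false_and, if_false, if_true, mul_zero, add_zero, le_refl]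
  · have h1 : ¬ ⟪g, ν⟫_ℝ < 0 := by rw [heq]; exact lt_irrefl 0
    have h3 : ⟪-g, ν⟫_ℝ = 0 := by rw [inner_neg_left, heq, neg_zero]
    have h2 : ¬ ⟪-g, ν⟫_ℝ < 0 := by rw [h3]; exact lt_irrefl 0
    have hA : ¬ (⟪g, ν⟫_ℝ < 0 ∧ ((∃ u ∈ K, 1 / 2 < ⟪u, g⟫_ℝ) ∨ ⟪g, ν⟫_ℝ ≤ -t)) := fun h => h1 h.1
    have hB : ¬ (⟪-g, ν⟫_ℝ < 0 ∧ ((∃ u ∈ K, 1 / 2 < ⟪u, -g⟫_ℝ) ∨ ⟪-g, ν⟫_ℝ ≤ -t)) := fun h => h2 h.1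
    rw [if_neg hA, if_neg hB, if_neg h1, if_pos heq]
    have e1 : (if ⟪g, ν⟫_ℝ = 0 ∧ (∃ u ∈ K, 1 / 2 < ⟪u, g⟫_ℝ) then (1 : ℝ) else 0) ≤ 1 := by
      split_ifs <;> norm_num
    have e2 : (if ⟪-g, ν⟫_ℝ = 0 ∧ (∃ u ∈ K, 1 / 2 < ⟪u, -g⟫_ℝ) then (1 : ℝ) else 0) ≤
        2 * (if (∃ u ∈ K, 1 / 2 < ⟪u, -g⟫_ℝ) ∨ ⟪-g, ν⟫_ℝ ≤ -t then (1 : ℝ) else 0) := by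
      by_cases hBm : ∃ u ∈ K, 1 / 2 < ⟪u, -g⟫_ℝ
      · rw [if_pos (Or.inl hBm)]; split_ifs <;> norm_num
      · rw [if_neg (fun h => hBm h.2)]; split_ifs <;> norm_num
    linarith
  · have h1 : ¬ ⟪g, ν⟫_ℝ < 0 := not_lt.2 hgt.le
    have h2 : ¬ ⟪g, ν⟫_ℝ = 0 := ne_of_gt hgt
    have h3 : ⟪-g, ν⟫_ℝ < 0 := by rw [inner_neg_left]; linarith
    have h4 : ¬ ⟪-g, ν⟫_ℝ = 0 := ne_of_lt h3
    simp only [h1, h2, h3, h4, true_and, false_and, if_false, mul_zero, add_zero, zero_add, le_refl]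

/-- **Down pair.**  For an antipodal pair `±v` with `v` strictly `ν`-below, the landed credits are exactly
the pred-slot credit of `v`. -/
theorem pair_down_le (v ν : EuclideanSpace ℝ (Fin 3)) (K : Finset (EuclideanSpace ℝ (Fin 3))) (t : ℝ)
    (hv : ⟪v, ν⟫_ℝ < 0) :
    ((if ⟪v, ν⟫_ℝ < 0 ∧ ((∃ u ∈ K, 1 / 2 < ⟪u, v⟫_ℝ) ∨ ⟪v, ν⟫_ℝ ≤ -t) then (1 : ℝ) else 0) +
        1 / 2 * (if ⟪v, ν⟫_ℝ = 0 ∧ (∃ u ∈ K, 1 / 2 < ⟪u, v⟫_ℝ) then (1 : ℝ) else 0)) +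
      ((if ⟪-v, ν⟫_ℝ < 0 ∧ ((∃ u ∈ K, 1 / 2 < ⟪u, -v⟫_ℝ) ∨ ⟪-v, ν⟫_ℝ ≤ -t) then (1 : ℝ) else 0) +
        1 / 2 * (if ⟪-v, ν⟫_ℝ = 0 ∧ (∃ u ∈ K, 1 / 2 < ⟪u, -v⟫_ℝ) then (1 : ℝ) else 0)) ≤
      (if (∃ u ∈ K, 1 / 2 < ⟪u, v⟫_ℝ) ∨ ⟪v, ν⟫_ℝ ≤ -t then (1 : ℝ) else 0) := by
  have h1 : ¬ ⟪v, ν⟫_ℝ = 0 := ne_of_lt hv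
  have h2 : ¬ ⟪-v, ν⟫_ℝ < 0 := by rw [inner_neg_left]; linarith
  have h3 : ¬ ⟪-v, ν⟫_ℝ = 0 := by rw [inner_neg_left]; linarith
  simp only [hv, h1, h2, h3, true_and, false_and, if_false, mul_zero, add_zero, le_refl]

/-- Integrality: a sum of six indicators that is at least `k − ½` is at least `k`. -/
theorem natCast_le_of_le_indicators_add_half (k : ℕ) (p₁ p₂ p₃ p₄ p₅ p₆ : Prop) [Decidable p₁]
    [Decidable p₂] [Decidable p₃] [Decidable p₄] [Decidable p₅] [Decidable p₆]
    (h : (k : ℝ) ≤ (if p₁ then (1 : ℝ) else 0) + (if p₂ then (1 : ℝ) else 0) + (if p₃ then (1 : ℝ) else 0) +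
      (if p₄ then (1 : ℝ) else 0) + (if p₅ then (1 : ℝ) else 0) + (if p₆ then (1 : ℝ) else 0) + 1 / 2) :
    (k : ℝ) ≤ (if p₁ then (1 : ℝ) else 0) + (if p₂ then (1 : ℝ) else 0) + (if p₃ then (1 : ℝ) else 0) +
      (if p₄ then (1 : ℝ) else 0) + (if p₅ then (1 : ℝ) else 0) + (if p₆ then (1 : ℝ) else 0) := by
  set n : ℕ := (if p₁ then 1 else 0) + (if p₂ then 1 else 0) + (if p₃ then 1 else 0) +
      (if p₄ then 1 else 0) + (if p₅ then 1 else 0) + (if p₆ then 1 else 0) with hn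
  have hcast : (n : ℝ) = (if p₁ then (1 : ℝ) else 0) + (if p₂ then (1 : ℝ) else 0) +
      (if p₃ then (1 : ℝ) else 0) + (if p₄ then (1 : ℝ) else 0) + (if p₅ then (1 : ℝ) else 0) +
      (if p₆ then (1 : ℝ) else 0) := by
    rw [hn]; push_cast; rfl
  rw [← hcast] at h ⊢
  have hlt : (k : ℝ) < n + 1 := by linarith
  have : k < n + 1 := by exact_mod_cast hlt
  exact_mod_cast Nat.lt_add_one_iff.mp this

/-! ### The axis-parallel normal: one contact blocks two up bonds, three contacts block all three -/

/-- With `h = √(2/3)`: a unit vector `(x, y, z)` with `z > h` has inner product `> ½` with at least two of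
the three up bonds `(±½, √3/6, h)`, `(0, −√3/3, h)` (their sum of inner products is `3 h z > 2`, each is
`≤ 1`). -/
theorem upBonds_two_blocked {x y z : ℝ} (hu : x ^ 2 + y ^ 2 + z ^ 2 = 1) (hz : Real.sqrt (2 / 3) < z) :
    (2 : ℝ) ≤ (if 1 / 2 < 1 / 2 * x + Real.sqrt 3 / 6 * y + Real.sqrt (2 / 3) * z then (1 : ℝ) else 0) +
      (if 1 / 2 < -(1 / 2) * x + Real.sqrt 3 / 6 * y + Real.sqrt (2 / 3) * z then (1 : ℝ) else 0) +
      (if 1 / 2 < -(Real.sqrt 3 / 3) * y + Real.sqrt (2 / 3) * z then (1 : ℝ) else 0) := by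
  have h3 : Real.sqrt 3 ^ 2 = 3 := Real.sq_sqrt (by norm_num)
  have h23 : Real.sqrt (2 / 3) ^ 2 = 2 / 3 := Real.sq_sqrt (by norm_num)
  have hpos : 0 < Real.sqrt (2 / 3) := Real.sqrt_pos.2 (by norm_num)
  have hsum : 2 < (1 / 2 * x + Real.sqrt 3 / 6 * y + Real.sqrt (2 / 3) * z) +
      (-(1 / 2) * x + Real.sqrt 3 / 6 * y + Real.sqrt (2 / 3) * z) +
      (-(Real.sqrt 3 / 3) * y + Real.sqrt (2 / 3) * z) := by nlinarith
  have b1 : 1 / 2 * x + Real.sqrt 3 / 6 * y + Real.sqrt (2 / 3) * z ≤ 1 := by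
    nlinarith [sq_nonneg (x - 1 / 2), sq_nonneg (y - Real.sqrt 3 / 6), sq_nonneg (z - Real.sqrt (2 / 3))]
  have b2 : -(1 / 2) * x + Real.sqrt 3 / 6 * y + Real.sqrt (2 / 3) * z ≤ 1 := by
    nlinarith [sq_nonneg (x + 1 / 2), sq_nonneg (y - Real.sqrt 3 / 6), sq_nonneg (z - Real.sqrt (2 / 3))]
  have b3 : -(Real.sqrt 3 / 3) * y + Real.sqrt (2 / 3) * z ≤ 1 := by
    nlinarith [sq_nonneg x, sq_nonneg (y + Real.sqrt 3 / 3), sq_nonneg (z - Real.sqrt (2 / 3))]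
  split_ifs <;> linarith

/-- Three pairwise-negative products are impossible. -/
theorem not_three_neg_products {p₁ p₂ p₃ : ℝ} (h12 : p₁ * p₂ < 0) (h13 : p₁ * p₃ < 0) (h23 : p₂ * p₃ < 0) :
    False := by
  have h : 0 < (p₁ * p₂) * (p₁ * p₃) := mul_pos_of_neg_of_neg h12 h13
  nlinarith [sq_nonneg p₁]

/-- With `h = √(2/3)` and `(r₀, r₁)` of squared length `1/3`: three unit vectors with third coordinates
`> h` and pairwise inner products `≤ ½` cannot all have inner product `≤ ½` with the up bond
`(r₀, r₁, h)` (their horizontal parts would be pairwise obtuse inside an open half-plane; the unit-norm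
hypotheses are not even needed). -/
theorem upBond_blocked_of_three {r₀ r₁ : ℝ} (hr : r₀ ^ 2 + r₁ ^ 2 = 1 / 3)
    {x₁ y₁ z₁ x₂ y₂ z₂ x₃ y₃ z₃ : ℝ}
    (hz₁ : Real.sqrt (2 / 3) < z₁) (hz₂ : Real.sqrt (2 / 3) < z₂) (hz₃ : Real.sqrt (2 / 3) < z₃)
    (h12 : x₁ * x₂ + y₁ * y₂ + z₁ * z₂ ≤ 1 / 2) (h13 : x₁ * x₃ + y₁ * y₃ + z₁ * z₃ ≤ 1 / 2)
    (h23 : x₂ * x₃ + y₂ * y₃ + z₂ * z₃ ≤ 1 / 2)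
    (hs₁ : r₀ * x₁ + r₁ * y₁ + Real.sqrt (2 / 3) * z₁ ≤ 1 / 2)
    (hs₂ : r₀ * x₂ + r₁ * y₂ + Real.sqrt (2 / 3) * z₂ ≤ 1 / 2)
    (hs₃ : r₀ * x₃ + r₁ * y₃ + Real.sqrt (2 / 3) * z₃ ≤ 1 / 2) : False := by
  have h23' : Real.sqrt (2 / 3) ^ 2 = 2 / 3 := Real.sq_sqrt (by norm_num)
  have hpos : 0 < Real.sqrt (2 / 3) := Real.sqrt_pos.2 (by norm_num)
  -- the horizontal projections onto `r`: all `< -1/6`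
  have e₁ : 0 < Real.sqrt (2 / 3) * (z₁ - Real.sqrt (2 / 3)) := mul_pos hpos (sub_pos.2 hz₁)
  have e₂ : 0 < Real.sqrt (2 / 3) * (z₂ - Real.sqrt (2 / 3)) := mul_pos hpos (sub_pos.2 hz₂)
  have e₃ : 0 < Real.sqrt (2 / 3) * (z₃ - Real.sqrt (2 / 3)) := mul_pos hpos (sub_pos.2 hz₃)
  have q1 : r₀ * x₁ + r₁ * y₁ < -(1 / 6) := by nlinarith
  have q2 : r₀ * x₂ + r₁ * y₂ < -(1 / 6) := by nlinarith
  have q3 : r₀ * x₃ + r₁ * y₃ < -(1 / 6) := by nlinarith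
  -- the horizontal inner products: all `< -1/6`
  have f12 : 0 < (z₁ - Real.sqrt (2 / 3)) * (z₂ - Real.sqrt (2 / 3)) := mul_pos (sub_pos.2 hz₁) (sub_pos.2 hz₂)
  have f13 : 0 < (z₁ - Real.sqrt (2 / 3)) * (z₃ - Real.sqrt (2 / 3)) := mul_pos (sub_pos.2 hz₁) (sub_pos.2 hz₃)
  have f23 : 0 < (z₂ - Real.sqrt (2 / 3)) * (z₃ - Real.sqrt (2 / 3)) := mul_pos (sub_pos.2 hz₂) (sub_pos.2 hz₃)
  have d12 : x₁ * x₂ + y₁ * y₂ < -(1 / 6) := by nlinarith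
  have d13 : x₁ * x₃ + y₁ * y₃ < -(1 / 6) := by nlinarith
  have d23 : x₂ * x₃ + y₂ * y₃ < -(1 / 6) := by nlinarith
  -- Lagrange identity: `|r|² ⟪v, w⟫ = (r·v)(r·w) + (r×v)(r×w)`
  have L : ∀ X Y X' Y' : ℝ, (r₀ ^ 2 + r₁ ^ 2) * (X * X' + Y * Y') =
      (r₀ * X + r₁ * Y) * (r₀ * X' + r₁ * Y') + (r₀ * Y - r₁ * X) * (r₀ * Y' - r₁ * X') := by
    intro X Y X' Y'; ring
  have p12 : (r₀ * y₁ - r₁ * x₁) * (r₀ * y₂ - r₁ * x₂) < 0 := by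
    have hq : 0 < (r₀ * x₁ + r₁ * y₁) * (r₀ * x₂ + r₁ * y₂) :=
      mul_pos_of_neg_of_neg (q1.trans (by norm_num)) (q2.trans (by norm_num))
    have := L x₁ y₁ x₂ y₂; rw [hr] at this; linarith
  have p13 : (r₀ * y₁ - r₁ * x₁) * (r₀ * y₃ - r₁ * x₃) < 0 := by
    have hq : 0 < (r₀ * x₁ + r₁ * y₁) * (r₀ * x₃ + r₁ * y₃) :=
      mul_pos_of_neg_of_neg (q1.trans (by norm_num)) (q3.trans (by norm_num))
    have := L x₁ y₁ x₃ y₃; rw [hr] at this; linarith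
  have p23 : (r₀ * y₂ - r₁ * x₂) * (r₀ * y₃ - r₁ * x₃) < 0 := by
    have hq : 0 < (r₀ * x₂ + r₁ * y₂) * (r₀ * x₃ + r₁ * y₃) :=
      mul_pos_of_neg_of_neg (q2.trans (by norm_num)) (q3.trans (by norm_num))
    have := L x₂ y₂ x₃ y₃; rw [hr] at this; linarith
  exact not_three_neg_products p12 p13 p23


/-- **Hex pair, mirrored representative.**  As `pair_hex_le`, with the pred-slot representative computed
from `g = −v` (the landed pair credits are symmetric in `±v`). -/
theorem pair_hex_le' (v ν : EuclideanSpace ℝ (Fin 3)) (K : Finset (EuclideanSpace ℝ (Fin 3))) (t : ℝ) :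
    ((if ⟪v, ν⟫_ℝ < 0 ∧ ((∃ u ∈ K, 1 / 2 < ⟪u, v⟫_ℝ) ∨ ⟪v, ν⟫_ℝ ≤ -t) then (1 : ℝ) else 0) +
        1 / 2 * (if ⟪v, ν⟫_ℝ = 0 ∧ (∃ u ∈ K, 1 / 2 < ⟪u, v⟫_ℝ) then (1 : ℝ) else 0)) +
      ((if ⟪-v, ν⟫_ℝ < 0 ∧ ((∃ u ∈ K, 1 / 2 < ⟪u, -v⟫_ℝ) ∨ ⟪-v, ν⟫_ℝ ≤ -t) then (1 : ℝ) else 0) +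
        1 / 2 * (if ⟪-v, ν⟫_ℝ = 0 ∧ (∃ u ∈ K, 1 / 2 < ⟪u, -v⟫_ℝ) then (1 : ℝ) else 0)) ≤
      (if (∃ u ∈ K, 1 / 2 < ⟪u, if ⟪-v, ν⟫_ℝ < 0 then -v else -(-v)⟫_ℝ) ∨
            ⟪(if ⟪-v, ν⟫_ℝ < 0 then -v else -(-v)), ν⟫_ℝ ≤ -t then (1 : ℝ) else 0) +
        1 / 2 * (if ⟪v, ν⟫_ℝ = 0 then (1 : ℝ) else 0) := by
  rcases lt_trichotomy ⟪v, ν⟫_ℝ 0 with hlt | heq | hgt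
  · have h1 : ¬ ⟪v, ν⟫_ℝ = 0 := ne_of_lt hlt
    have h2 : ¬ ⟪-v, ν⟫_ℝ < 0 := by rw [inner_neg_left]; linarith
    have h3 : ¬ ⟪-v, ν⟫_ℝ = 0 := by rw [inner_neg_left]; linarith
    simp only [hlt, h1, h2, h3, true_and, false_and, if_false, mul_zero, add_zero, neg_neg, le_refl]
  · have h1 : ¬ ⟪v, ν⟫_ℝ < 0 := by rw [heq]; exact lt_irrefl 0
    have h3 : ⟪-v, ν⟫_ℝ = 0 := by rw [inner_neg_left, heq, neg_zero]
    have h2 : ¬ ⟪-v, ν⟫_ℝ < 0 := by rw [h3]; exact lt_irrefl 0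
    have hA : ¬ (⟪v, ν⟫_ℝ < 0 ∧ ((∃ u ∈ K, 1 / 2 < ⟪u, v⟫_ℝ) ∨ ⟪v, ν⟫_ℝ ≤ -t)) := fun h => h1 h.1
    have hB : ¬ (⟪-v, ν⟫_ℝ < 0 ∧ ((∃ u ∈ K, 1 / 2 < ⟪u, -v⟫_ℝ) ∨ ⟪-v, ν⟫_ℝ ≤ -t)) := fun h => h2 h.1
    rw [if_neg hA, if_neg hB, if_neg h2, if_pos heq, neg_neg]
    have e1 : (if ⟪-v, ν⟫_ℝ = 0 ∧ (∃ u ∈ K, 1 / 2 < ⟪u, -v⟫_ℝ) then (1 : ℝ) else 0) ≤ 1 := by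
      split_ifs <;> norm_num
    have e2 : (if ⟪v, ν⟫_ℝ = 0 ∧ (∃ u ∈ K, 1 / 2 < ⟪u, v⟫_ℝ) then (1 : ℝ) else 0) ≤
        2 * (if (∃ u ∈ K, 1 / 2 < ⟪u, v⟫_ℝ) ∨ ⟪v, ν⟫_ℝ ≤ -t then (1 : ℝ) else 0) := by
      by_cases hBp : ∃ u ∈ K, 1 / 2 < ⟪u, v⟫_ℝ
      · rw [if_pos (Or.inl hBp)]; split_ifs <;> norm_num
      · rw [if_neg (fun h => hBp h.2)]; split_ifs <;> norm_num
    linarith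
  · have h1 : ¬ ⟪v, ν⟫_ℝ < 0 := not_lt.2 hgt.le
    have h2 : ¬ ⟪v, ν⟫_ℝ = 0 := ne_of_gt hgt
    have h3 : ⟪-v, ν⟫_ℝ < 0 := by rw [inner_neg_left]; linarith
    have h4 : ¬ ⟪-v, ν⟫_ℝ = 0 := ne_of_lt h3
    simp only [h1, h2, h3, h4, true_and, false_and, if_false, if_true, mul_zero, add_zero, zero_add, le_refl]

/-! ### Coordinates of the hex bonds, the up bonds and the axis -/

/-- Inner products of the three hex bonds `h₁ = (1,0,0)`, `h₂ = (½, √3/2, 0)`, `h₃ = (½, −√3/2, 0)`, the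
three up bonds `w₁ = (½, √3/6, h)`, `w₂ = (−½, √3/6, h)`, `w₃ = (0, −√3/3, h)` (`h = √(2/3)`) and the axis
`e₃` with any `p`, in coordinates. -/
theorem hexUp_inner_apply (p : EuclideanSpace ℝ (Fin 3)) :
    ⟪barlowPos 1 (Real.sqrt (2 / 3)) constHagg 0 1 0, p⟫_ℝ = p 0 ∧
    ⟪barlowPos 1 (Real.sqrt (2 / 3)) constHagg 0 0 1, p⟫_ℝ = 1 / 2 * p 0 + Real.sqrt 3 / 2 * p 1 ∧
    ⟪barlowPos 1 (Real.sqrt (2 / 3)) constHagg 0 1 (-1), p⟫_ℝ = 1 / 2 * p 0 - Real.sqrt 3 / 2 * p 1 ∧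
    ⟪barlowPos 1 (Real.sqrt (2 / 3)) constHagg 1 0 0, p⟫_ℝ =
      1 / 2 * p 0 + Real.sqrt 3 / 6 * p 1 + Real.sqrt (2 / 3) * p 2 ∧
    ⟪barlowPos 1 (Real.sqrt (2 / 3)) constHagg 1 (-1) 0, p⟫_ℝ =
      -(1 / 2) * p 0 + Real.sqrt 3 / 6 * p 1 + Real.sqrt (2 / 3) * p 2 ∧
    ⟪barlowPos 1 (Real.sqrt (2 / 3)) constHagg 1 0 (-1), p⟫_ℝ =
      -(Real.sqrt 3 / 3) * p 1 + Real.sqrt (2 / 3) * p 2 ∧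
    ⟪EuclideanSpace.single (2 : Fin 3) (1 : ℝ), p⟫_ℝ = p 2 := by
  refine ⟨?_, ?_, ?_, ?_, ?_, ?_, bgf_inner_e3_left p⟩ <;>
    simp only [inner_fin_three, barlowPos_apply_zero, barlowPos_apply_one, barlowPos_apply_two,
      haggLabel_const] <;> push_cast <;> ring

/-- The up bonds `w₂`, `w₃` are the negatives of the star members `(−1,1,0)`, `(−1,0,1)`. -/
theorem upBonds_eq_neg :
    barlowPos 1 (Real.sqrt (2 / 3)) constHagg (-1) 1 0 = -barlowPos 1 (Real.sqrt (2 / 3)) constHagg 1 (-1) 0 ∧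
    barlowPos 1 (Real.sqrt (2 / 3)) constHagg (-1) 0 1 = -barlowPos 1 (Real.sqrt (2 / 3)) constHagg 1 0 (-1) := by
  constructor <;> ext l <;> fin_cases l <;>
    simp [barlowPos_apply_zero, barlowPos_apply_one, barlowPos_apply_two] <;> ring


/-! ### The half-turn about the axis, and the two letters -/

/-- The half-turn `R_π = (−1) ∘ M` about the axis as a formula: `R_π x = −x + 2 x₂ e₃`. -/
theorem halfTurn_eq (x : EuclideanSpace ℝ (Fin 3)) :
    (((ℝ ∙ (EuclideanSpace.single (2 : Fin 3) (1 : ℝ)))ᗮ.reflection).trans (LinearIsometryEquiv.neg ℝ)) x = -x + (2 * x 2) • EuclideanSpace.single (2 : Fin 3) (1 : ℝ) := by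
  simp only [LinearIsometryEquiv.trans_apply, LinearIsometryEquiv.coe_neg]
  rw [basalMirror_eq, neg_sub, sub_eq_neg_add]

/-- The half-turn negates the hex bonds, maps the up bonds of letter `+1` to those of letter `−1`, and
fixes the axis. -/
theorem halfTurn_bonds :
    (((ℝ ∙ (EuclideanSpace.single (2 : Fin 3) (1 : ℝ)))ᗮ.reflection).trans (LinearIsometryEquiv.neg ℝ)) (barlowPos 1 (Real.sqrt (2 / 3)) constHagg 0 1 0) = -barlowPos 1 (Real.sqrt (2 / 3)) constHagg 0 1 0 ∧
    (((ℝ ∙ (EuclideanSpace.single (2 : Fin 3) (1 : ℝ)))ᗮ.reflection).trans (LinearIsometryEquiv.neg ℝ)) (barlowPos 1 (Real.sqrt (2 / 3)) constHagg 0 0 1) = -barlowPos 1 (Real.sqrt (2 / 3)) constHagg 0 0 1 ∧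
    (((ℝ ∙ (EuclideanSpace.single (2 : Fin 3) (1 : ℝ)))ᗮ.reflection).trans (LinearIsometryEquiv.neg ℝ)) (barlowPos 1 (Real.sqrt (2 / 3)) constHagg 0 1 (-1)) = -barlowPos 1 (Real.sqrt (2 / 3)) constHagg 0 1 (-1) ∧
    (((ℝ ∙ (EuclideanSpace.single (2 : Fin 3) (1 : ℝ)))ᗮ.reflection).trans (LinearIsometryEquiv.neg ℝ)) (barlowPos 1 (Real.sqrt (2 / 3)) constHagg 1 0 0) = barlowPos 1 (Real.sqrt (2 / 3)) (fun _ : ℤ => (-1 : ℤ)) 1 0 0 ∧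
    (((ℝ ∙ (EuclideanSpace.single (2 : Fin 3) (1 : ℝ)))ᗮ.reflection).trans (LinearIsometryEquiv.neg ℝ)) (barlowPos 1 (Real.sqrt (2 / 3)) constHagg 1 (-1) 0) = barlowPos 1 (Real.sqrt (2 / 3)) (fun _ : ℤ => (-1 : ℤ)) 1 1 0 ∧
    (((ℝ ∙ (EuclideanSpace.single (2 : Fin 3) (1 : ℝ)))ᗮ.reflection).trans (LinearIsometryEquiv.neg ℝ)) (barlowPos 1 (Real.sqrt (2 / 3)) constHagg 1 0 (-1)) = barlowPos 1 (Real.sqrt (2 / 3)) (fun _ : ℤ => (-1 : ℤ)) 1 0 1 ∧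
    (((ℝ ∙ (EuclideanSpace.single (2 : Fin 3) (1 : ℝ)))ᗮ.reflection).trans (LinearIsometryEquiv.neg ℝ)) (EuclideanSpace.single (2 : Fin 3) (1 : ℝ)) = EuclideanSpace.single (2 : Fin 3) (1 : ℝ) := by
  have L1 := haggLabel_const_one (-1)
  refine ⟨?_, ?_, ?_, ?_, ?_, ?_, ?_⟩ <;> rw [halfTurn_eq] <;> ext l <;> fin_cases l <;> simp [L1] <;> ring

end Summit.Ventures.Crystal3D.Theorems

end
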